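import Summits.QuantumFields.YangMills.Theorems.FluctuationComparisonRegPrIntLSupTailReduction
import Summits.QuantumFields.YangMills.Theorems.FluctuationComparisonRegPrIntLSupTailModulus
import Summits.QuantumFields.YangMills.Theorems.FluctuationComparisonRegPrIntLSupTailDepthInduction
import HarnessLib

/-!
# `FluctuationComparisonRegPrIntLSupTailCoverUnion` — LINES g21-1 ∕ g21-2: COND-ODDS AT ANY DEPTH FROM A FINITE REGIME COVER OF THE BAD HISTORIES (the union-bound glue,
# importable and depth-free; crux `UnitScaleTilt.FluctuationComparisonRegPrIntL`, stmt-QuantumFields-20520; companion of ✓`…SupTailReduction` (A), whose hypothesis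
# COND-ODDS it produces from regime rows of the MOD ∕ FAR ∕ pinned kind)

Cell `ym3-torus` (YM ladder rung R3 = continuum SU(2) Yang–Mills on T³ — a RUNG, NOT the Clay problem: not d = 4, not infinite volume, not a mass gap);
width seat `ym-ust-20520-w3` (gen 17); helper `--supports stmt-QuantumFields-20520`.  THEOREMS ONLY (0 `def`, 0 `sorry`, default heartbeats).

WHAT.  LINE g21-2 proves (in its Cruxes workfile, depth one) MOD₁ ∧ FAR₁ ⇒ COND-ODDS₁ and PPT ∕ FPT ⇒ MOD₁ ∕ FAR₁ by union bounds.  This file is the importable,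
DEPTH-FREE form of that glue: if the bad histories inside `D⁻¹B` are covered by finitely many regime events `E_i` and each regime is dominated by the good mass,
`μ(D⁻¹B ∩ E_i) ≤ σ_i·μ(D⁻¹B ∩ G)`, then `μ(D⁻¹B) ≤ (1 + Σσ_i)·μ(D⁻¹B ∩ G)` — COND-ODDS's inequality with `e^{τ} := 1 + Σσ_i` (`τ = log(1 + Σσ) ≤ Σσ`).
* §1 (generic, any measure) ★★`measure_le_one_add_sum_mul_of_cover` — `A ∖ G ⊆ ⋃_{i∈s} E_i`, `μ(A ∩ E_i) ≤ σ_i·μ(A ∩ G)` ⇒ `μ A ≤ (1 + Σ_{i∈s} σ_i)·μ(A ∩ G)` (`ℝ≥0∞`);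
  `setwise_of_restrict_map_le_smul` — ✓E's ROW SHAPE `(D_*(μ|E))|W ≤ c•(D_*(μ|G))|W` read back setwise: `μ(D⁻¹B ∩ E) ≤ c·μ(D⁻¹B ∩ G)` for measurable `B ⊆ W`
  (converse of ✓E `restrict_map_le_smul_of_setwise`; so MOD₁ ∕ FAR₁ ∕ PPT ∕ FPT rows typed in ✓E's shape feed §2–§4 directly).
* §2 (the runs) ★★★`condGoodOdds_of_regimeCover` — at any `(J, K)` and any thresholds `θ : ℕ → ℝ`: regime rows `Gibbs_K(D⁻¹B ∩ E_i) ≤ ofReal(σ_i)·Gibbs_K(D⁻¹B ∩ histGood θ K J)`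
  with `D⁻¹B ∖ histGood θ K J ⊆ ⋃ E_i` give `Gibbs_K(D⁻¹B) ≤ ofReal(exp(log(1 + Σσ_i)))·Gibbs_K(D⁻¹B ∩ histGood θ K J)`; `log_one_add_sum_le` (`τ ≤ Σσ`).
* §3 (pinned rows, the canonical cover) `preimage_diff_histGood_subset` — for `B` inside the level-`J` window, `D_{J,K}⁻¹B ∖ histGood θ K J ⊆ ⋃_{J<j≤K} ⋃_{p} {θ_j ≤ dist1(plaqHol (D_{j,K}U) p)}`
  (via ✓J `mem_histGood_iff_descendTo`); ★★★`condGoodOdds_of_pinnedRows` — PINNED rows `Gibbs_K(D⁻¹B ∩ {θ_j ≤ dist1((D_{j,K}U)(∂p))}) ≤ ofReal(σ_j p)·Gibbs_K(D⁻¹B ∩ histGood)`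
  for every level `J < j ≤ K` and plaquette `p` of level `j` ⇒ COND-ODDS at `(J, K)` with `e^{τ} = 1 + Σ_{j∈(J,K]} Σ_p σ_j p` (LINE g21-2's PPT ∕ FPT ⇒ COND-ODDS, all depths).
* §4 (the profile) `card_plaq_level_le` (`#Plaq(T_j) ≤ 9·8L^{3m}(L^j)³`), `sum_pinnedProfile_le` (plaquette-uniform weights `C β_j^A e^{−c·pFun(g_j)²}` sum to `≤ A'·2^{−J}`
  uniformly in `K`, via ✓B `sum_perHeight_le_geometric`); ★★★`condGoodOdds_of_pinnedProfile` — PINNED ROWS WITH BAŁABAN'S PROFILE WEIGHT at every `(J, K, j, p)` ⇒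
  ✓A's hypothesis ⟨COND-ODDS⟩ VERBATIM (`τ J = A'·2^{−J}`, superpolynomial) — so ✓A `windowOddsSupCan_of_condGoodOdds` turns per-plaquette pinned rows into TAILSUP.
* §5 (the door, one name) ★★★`windowOddsSup_of_pinnedProfile` — ⟨PINNED-PROFILE⟩ ⇒ LINE g21-1's row TAILSUP `WindowOddsSupCan` TEXT VERBATIM (§4 ∘ ✓A).
HONEST SCOPE.  Measure arithmetic; the regime rows are HYPOTHESES; TAILSUP, MOD, FAR, LFR♯ᶜ, S2β, 20520, `YM3TorusSU2` NOT proved; the Yang–Mills mass gap is NOT proved.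
References: [Balaban1985UV3] (7) p. 257 (decomposition of unity into small- and large-field terms), (38)–(40) p. 266.
-/

noncomputable section

set_option autoImplicit false

open MeasureTheory Filter Topology Set
open scoped ENNReal NNReal BigOperators
open Literature.MathematicalPhysics.QuantumFieldTheory.Balaban1983to89
open Literature.MathematicalPhysics.QuantumFieldTheory.Balaban1983to89.T3ContinuumYM3Torus
open Literature.MathematicalPhysics.QuantumFieldTheory.Balaban1983to89.T3NestedUnitLaws
open Literature.MathematicalPhysics.QuantumFieldTheory.Balaban1983to89.T3UnitLawDensityEML
open Literature.MathematicalPhysics.QuantumFieldTheory.Balaban1983to89.T3UnitScaleTilt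
open Literature.MathematicalPhysics.QuantumFieldTheory.Balaban1983to89.T3TiltDescent
open Literature.MathematicalPhysics.QuantumFieldTheory.Balaban1983to89.Missing
open scoped Literature.MathematicalPhysics.QuantumFieldTheory.Balaban1983to89.T3OrbitAverage
open Summit.QuantumFields.YangMills.Theorems.FluctuationComparisonRegPrIntLWregGlue (heightDensityCan)

namespace Summit.QuantumFields.YangMills.Theorems.FluctuationComparisonRegPrIntLSupTailCoverUnion

/-! ## §1 Generic: a finite regime cover of the bad part, each regime dominated by the good mass -/

/-- ★★ **COVER ⇒ ODDS**: for any measure `μ`, a set `A`, a measurable `G`, a finite family of sets `E_i` (`i ∈ s`) covering `A ∖ G`, and weights `σ_i` with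
`μ(A ∩ E_i) ≤ σ_i·μ(A ∩ G)`: `μ A ≤ (1 + Σ_{i∈s} σ_i)·μ(A ∩ G)` (`μ A ≤ μ(A ∩ G) + μ(A ∖ G)`, subadditivity over the cover). [folklore] -/
theorem measure_le_one_add_sum_mul_of_cover {X : Type*} [MeasurableSpace X] (μ : Measure X) {ι : Type*} (s : Finset ι) (E : ι → Set X) {A G : Set X}
    (hG : MeasurableSet G) (hcover : A \ G ⊆ ⋃ i ∈ s, E i) (σ : ι → ℝ≥0∞) (hdom : ∀ i ∈ s, μ (A ∩ E i) ≤ σ i * μ (A ∩ G)) :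
    μ A ≤ (1 + ∑ i ∈ s, σ i) * μ (A ∩ G) := by
  have hsplit : μ A ≤ μ (A ∩ G) + μ (A \ G) := by
    rw [← measure_inter_add_sdiff A hG]
  have hbad : μ (A \ G) ≤ ∑ i ∈ s, μ (A ∩ E i) := by
    calc μ (A \ G) ≤ μ (⋃ i ∈ s, (A ∩ E i)) := by
          refine measure_mono fun x hx => ?_
          have hx' := hcover hx
          simp only [Set.mem_iUnion] at hx' ⊢
          obtain ⟨i, hi, hxi⟩ := hx'
          exact ⟨i, hi, hx.1, hxi⟩
      _ ≤ ∑ i ∈ s, μ (A ∩ E i) := measure_biUnion_finset_le s _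
  calc μ A ≤ μ (A ∩ G) + μ (A \ G) := hsplit
    _ ≤ μ (A ∩ G) + ∑ i ∈ s, σ i * μ (A ∩ G) := by
        refine add_le_add le_rfl (hbad.trans (Finset.sum_le_sum fun i hi => hdom i hi))
    _ = (1 + ∑ i ∈ s, σ i) * μ (A ∩ G) := by
        rw [add_mul, one_mul, Finset.sum_mul]

/-- `log (1 + Σσ_i) ≤ Σσ_i` for non-negative weights (so the odds constant `1 + Σσ` is `e^{τ}` with `τ ≤ Σσ`). [folklore] -/
theorem log_one_add_sum_le {ι : Type*} (s : Finset ι) (σ : ι → ℝ) (hσ : ∀ i ∈ s, 0 ≤ σ i) :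
    Real.log (1 + ∑ i ∈ s, σ i) ≤ ∑ i ∈ s, σ i := by
  have h0 : 0 ≤ ∑ i ∈ s, σ i := Finset.sum_nonneg hσ
  have h1 : 0 < 1 + ∑ i ∈ s, σ i := by linarith
  have := Real.add_one_le_exp (∑ i ∈ s, σ i)
  rw [Real.log_le_iff_le_exp h1]
  linarith

/-- `ofReal` of a finite sum of non-negative reals is the sum of the `ofReal`s, and `1 + ·` commutes with it. [folklore] -/
theorem ofReal_one_add_sum {ι : Type*} (s : Finset ι) (σ : ι → ℝ) (hσ : ∀ i ∈ s, 0 ≤ σ i) :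
    ENNReal.ofReal (1 + ∑ i ∈ s, σ i) = 1 + ∑ i ∈ s, ENNReal.ofReal (σ i) := by
  rw [ENNReal.ofReal_add zero_le_one (Finset.sum_nonneg hσ), ENNReal.ofReal_one, ENNReal.ofReal_sum_of_nonneg hσ]

/-- **✓E's ROW SHAPE, READ SETWISE**: if `(D_*(μ|E))|W ≤ c•(D_*(μ|G))|W` (the shape of ✓E `gibbsK_restrict_map_le_of_fibrewise` and of LINE g21-2's MOD₁ ∕ FAR₁ ∕ PPT ∕ FPT rows),
then `μ(D⁻¹B ∩ E) ≤ c·μ(D⁻¹B ∩ G)` for every measurable `B ⊆ W` — the setwise regime row §2–§4 consume (converse of ✓E `restrict_map_le_smul_of_setwise`). [folklore] -/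
theorem setwise_of_restrict_map_le_smul {α β : Type*} [MeasurableSpace α] [MeasurableSpace β] (μ : Measure β) {D : β → α} (hD : Measurable D)
    {E G : Set β} {W : Set α} {c : ℝ≥0∞} (h : (Measure.map D (μ.restrict E)).restrict W ≤ c • (Measure.map D (μ.restrict G)).restrict W)
    {B : Set α} (hB : MeasurableSet B) (hBW : B ⊆ W) : μ (D ⁻¹' B ∩ E) ≤ c * μ (D ⁻¹' B ∩ G) := by
  have h1 := Measure.le_iff.mp h B hB
  rw [Measure.restrict_apply hB, Measure.smul_apply, Measure.restrict_apply hB, smul_eq_mul, Set.inter_eq_self_of_subset_left hBW,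
    Measure.map_apply hD hB, Measure.map_apply hD hB, Measure.restrict_apply (hD hB), Measure.restrict_apply (hD hB)] at h1
  exact h1

/-! ## §2 The runs: COND-ODDS at `(J, K)` from regime rows dominated by the good histories -/

section Runs

variable (F : T3Family) (γ : ℝ) (θ : ℕ → ℝ) {J K : ℕ} (hJK : J ≤ K)

/-- ★★★ **COND-ODDS AT `(J, K)` ⟸ A FINITE REGIME COVER**: let `E_i` (`i ∈ s`) be sets of run-`K` fine fields covering the bad histories above `B`,
`D_{J,K}⁻¹B ∖ histGood θ K J ⊆ ⋃ E_i` (e.g. moderate ∪ far, or one pinned event per level and plaquette, §3), with regime rows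
`Gibbs_K(D⁻¹B ∩ E_i) ≤ ofReal(σ_i)·Gibbs_K(D⁻¹B ∩ histGood θ K J)` (`σ_i ≥ 0`).  Then
`Gibbs_K(D⁻¹B) ≤ ofReal(exp(log(1 + Σσ_i)))·Gibbs_K(D⁻¹B ∩ histGood θ K J)` — ✓A's COND-ODDS inequality (there `θ = θBal F.L γ b₀ p₀`) with `τ := log(1 + Σσ_i) ≤ Σσ_i`
(`log_one_add_sum_le`); thresholds `θ` and coupling `γ` are free letters (interior windows included). [cite: Balaban1985UV3, (7) p.257 and (38)-(40) p.266] -/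
theorem condGoodOdds_of_regimeCover {ι : Type*} (s : Finset ι) (E : ι → Set (GaugeField (F.P K) 0 (Matrix.specialUnitaryGroup (Fin 2) ℂ)))
    (σ : ι → ℝ) (hσ : ∀ i ∈ s, 0 ≤ σ i) {B : Set (GaugeField (F.P J) 0 (Matrix.specialUnitaryGroup (Fin 2) ℂ))}
    (hcover : descendTo F ℰp J K hJK ⁻¹' B \ histGood F ℰp θ K J ⊆ ⋃ i ∈ s, E i)
    (hrows : ∀ i ∈ s, gibbsK F ℰp γ K (descendTo F ℰp J K hJK ⁻¹' B ∩ E i) ≤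
          ENNReal.ofReal (σ i) * gibbsK F ℰp γ K (descendTo F ℰp J K hJK ⁻¹' B ∩ histGood F ℰp θ K J)) :
    gibbsK F ℰp γ K (descendTo F ℰp J K hJK ⁻¹' B) ≤
      ENNReal.ofReal (Real.exp (Real.log (1 + ∑ i ∈ s, σ i))) *
        gibbsK F ℰp γ K (descendTo F ℰp J K hJK ⁻¹' B ∩ histGood F ℰp θ K J) := by
  have hGm : MeasurableSet (histGood F ℰp θ K J) := measurableSet_histGood F ℰp measurableE_ℰp _ K J
  have hpos : 0 < 1 + ∑ i ∈ s, σ i := by linarith [Finset.sum_nonneg hσ]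
  rw [Real.exp_log hpos, ofReal_one_add_sum s σ hσ]
  exact measure_le_one_add_sum_mul_of_cover (gibbsK F ℰp γ K) s E hGm hcover (fun i => ENNReal.ofReal (σ i)) hrows

/-! ## §3 Pinned rows: the canonical cover of the bad histories by one event per level and plaquette -/

/-- **THE CANONICAL COVER**: for `B` inside the level-`J` window `{PlaqSmall (θ J)}`, a fine field above `B` with a bad history has SOME level `J < j ≤ K` and SOME
plaquette `p` of that level with `θ_j ≤ dist1((D_{j,K}U)(∂p))` (✓J `mem_histGood_iff_descendTo` negated; level `J` is supplied by `B`). [cite: Balaban1985UV3, (7) p.257] -/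
theorem preimage_diff_histGood_subset {B : Set (GaugeField (F.P J) 0 (Matrix.specialUnitaryGroup (Fin 2) ℂ))} (hBJ : B ⊆ {U | PlaqSmall (θ J) U}) :
    descendTo F ℰp J K hJK ⁻¹' B \ histGood F ℰp θ K J ⊆
      ⋃ x ∈ (Finset.Ioc J K).sigma (fun j => (Finset.univ : Finset (Plaq (F.P j) 0))),
        {U | ∀ h : (x : Σ j : ℕ, Plaq (F.P j) 0).1 ≤ K, θ x.1 ≤ dist1 (GaugeField.plaqHol (descendTo F ℰp x.1 K h U) x.2)} := by
  rintro U ⟨hUB, hUG⟩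
  rw [Set.mem_preimage] at hUB
  rw [FluctuationComparisonRegPrIntLSupTailDepthInduction.mem_histGood_iff_descendTo] at hUG
  simp only [not_forall] at hUG
  obtain ⟨j, hJj, hjK, hbad⟩ := hUG
  have hne : j ≠ J := by
    rintro rfl
    exact hbad (hBJ hUB)
  have hlt : J < j := lt_of_le_of_ne hJj (Ne.symm hne)
  simp only [PlaqSmall, not_forall, not_lt] at hbad
  obtain ⟨p, hp⟩ := hbad
  simp only [Set.mem_iUnion, Finset.mem_sigma, Finset.mem_Ioc, Finset.mem_univ, and_true, Set.mem_setOf_eq]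
  exact ⟨⟨j, p⟩, ⟨hlt, hjK⟩, fun h => hp⟩

/-- ★★★ **COND-ODDS AT `(J, K)` ⟸ PINNED ROWS AT EVERY LEVEL AND PLAQUETTE** (LINE g21-2's PPT ∕ FPT ⇒ MOD ∕ FAR ⇒ COND-ODDS, importable and for ALL depths): if for
every level `J < j ≤ K` and every plaquette `p` of level `j` the pinned bad event is dominated by the good mass above `B`,
`Gibbs_K(D_{J,K}⁻¹B ∩ {θ_j ≤ dist1((D_{j,K}U)(∂p))}) ≤ ofReal(σ_j p)·Gibbs_K(D_{J,K}⁻¹B ∩ histGood θ K J)` (`σ ≥ 0`), and `B` lies inside the level-`J` window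
`{PlaqSmall (θ J)}`, then `Gibbs_K(D⁻¹B) ≤ ofReal(exp(log(1 + Σ_{j∈(J,K]} Σ_p σ_j p)))·Gibbs_K(D⁻¹B ∩ histGood θ K J)`.  With `σ_j p = C·β_j^A·e^{−c·pFun(g_j)²}`
the double sum is `≤ A'·2^{−J}` uniformly in `K` (✓B `sum_perHeight_le_geometric`). [cite: Balaban1985UV3, (7) p.257 and (38)-(40) p.266] -/
theorem condGoodOdds_of_pinnedRows (σ : (j : ℕ) → Plaq (F.P j) 0 → ℝ) (hσ : ∀ j p, 0 ≤ σ j p)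
    {B : Set (GaugeField (F.P J) 0 (Matrix.specialUnitaryGroup (Fin 2) ℂ))} (hBJ : B ⊆ {U | PlaqSmall (θ J) U})
    (hrows : ∀ j, J < j → ∀ hjK : j ≤ K, ∀ p : Plaq (F.P j) 0,
      gibbsK F ℰp γ K (descendTo F ℰp J K hJK ⁻¹' B ∩ {U | θ j ≤ dist1 (GaugeField.plaqHol (descendTo F ℰp j K hjK U) p)}) ≤
        ENNReal.ofReal (σ j p) * gibbsK F ℰp γ K (descendTo F ℰp J K hJK ⁻¹' B ∩ histGood F ℰp θ K J)) :
    gibbsK F ℰp γ K (descendTo F ℰp J K hJK ⁻¹' B) ≤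
      ENNReal.ofReal (Real.exp (Real.log (1 + ∑ j ∈ Finset.Ioc J K, ∑ p : Plaq (F.P j) 0, σ j p))) *
        gibbsK F ℰp γ K (descendTo F ℰp J K hJK ⁻¹' B ∩ histGood F ℰp θ K J) := by
  have hsum : ∑ j ∈ Finset.Ioc J K, ∑ p : Plaq (F.P j) 0, σ j p =
      ∑ x ∈ (Finset.Ioc J K).sigma (fun j => (Finset.univ : Finset (Plaq (F.P j) 0))), σ x.1 x.2 := by
    rw [Finset.sum_sigma]
  rw [hsum]
  refine condGoodOdds_of_regimeCover F γ θ hJK ((Finset.Ioc J K).sigma (fun j => (Finset.univ : Finset (Plaq (F.P j) 0))))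
    (fun x : (Σ j : ℕ, Plaq (F.P j) 0) => {U | ∀ h : x.1 ≤ K, θ x.1 ≤ dist1 (GaugeField.plaqHol (descendTo F ℰp x.1 K h U) x.2)})
    (fun x => σ x.1 x.2) (fun x _ => hσ x.1 x.2) (preimage_diff_histGood_subset F θ hJK hBJ) ?_
  intro x hx
  simp only [Finset.mem_sigma, Finset.mem_Ioc] at hx
  obtain ⟨⟨_, hjK⟩, _⟩ := hx
  have hE : {U | ∀ h : x.1 ≤ K, θ x.1 ≤ dist1 (GaugeField.plaqHol (descendTo F ℰp x.1 K h U) x.2)} =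
      {U | θ x.1 ≤ dist1 (GaugeField.plaqHol (descendTo F ℰp x.1 K hjK U) x.2)} := by
    ext U
    simp only [Set.mem_setOf_eq]
    exact ⟨fun h => h hjK, fun h _ => h⟩
  rw [hE]
  exact hrows x.1 (by assumption) hjK x.2

/-! ## §4 The profile: plaquette-uniform weights `C β_j^A e^{−c·pFun(g_j)²}` ⇒ ✓A's ⟨COND-ODDS⟩ verbatim, `τ J = A'·2^{−J}` -/

/-- `#plaquettes of the level-`j` torus `T_j` (finest lattice of the `j`-th approximation, `2L^{m+j}` sites per direction) ≤ 9·(2L^{m+j})³ = 9·8L^{3m}(L^j)³`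
(`d² = 9` plane labels per site; same count as lit `T3AveragedTailProfile`'s private `card_plaq_le`). [cite: Balaban1985UV3, (1)-(3) p.256] -/
theorem card_plaq_level_le (j : ℕ) : (Fintype.card (Plaq (F.P j) 0) : ℝ) ≤ 9 * (8 * (F.L : ℝ) ^ (3 * F.m) * ((F.L : ℝ) ^ j) ^ 3) := by
  have h0 : (F.P j).sitesPerDir 0 = 2 * F.L ^ (F.m + j) := by
    show 2 * F.L ^ (F.m + j - 0) = 2 * F.L ^ (F.m + j)
    rw [Nat.sub_zero]
  have h1 : Fintype.card (Plaq (F.P j) 0) = Fintype.card (Literature.MathematicalPhysics.QuantumFieldTheory.Plaquette 3 ((F.P j).sitesPerDir 0)) :=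
    Fintype.card_congr (plaqEquiv (P := F.P j) 0)
  have h2 : Fintype.card (Literature.MathematicalPhysics.QuantumFieldTheory.Plaquette 3 ((F.P j).sitesPerDir 0)) ≤ ((F.P j).sitesPerDir 0) ^ 3 * 3 ^ 2 := by
    rw [Fintype.card_prod, Fintype.card_fun, ZMod.card, Fintype.card_fin]
    gcongr
    calc Fintype.card {p : Fin 3 × Fin 3 // p.1 < p.2} ≤ Fintype.card (Fin 3 × Fin 3) := Fintype.card_subtype_le _
      _ = 3 ^ 2 := by rw [Fintype.card_prod, Fintype.card_fin]; norm_num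
  rw [h1]
  calc (Fintype.card (Literature.MathematicalPhysics.QuantumFieldTheory.Plaquette 3 ((F.P j).sitesPerDir 0)) : ℝ) ≤ (((F.P j).sitesPerDir 0) ^ 3 * 3 ^ 2 : ℕ) := by
        exact_mod_cast h2
    _ = 9 * (8 * (F.L : ℝ) ^ (3 * F.m) * ((F.L : ℝ) ^ j) ^ 3) := by rw [h0]; push_cast; ring

/-- **THE PROFILE SUM, UNIFORM IN `K`** (`0 < γ ≤ 1`, `0 < b₀`, `1 ≤ p₀`, `C ≥ 0`, `c > 0`): the plaquette-uniform pinned weights `σ_j p = C·β_j^A·e^{−c·pFun b₀ p₀ (g_j)²}`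
(`g_j² = γL^{−j}`) have `Σ_{j∈(J,K]} Σ_{p∈T_j} σ_j p ≤ A'·2^{−J}` with ✓B's explicit `A'` — `#T_j`-many copies per level (`card_plaq_level_le`) and
✓B `sum_perHeight_le_geometric` on `(J, K] = [J+1, K+1)`. [cite: Balaban1985UV3, (7) p.257 and (71) p.273] -/
theorem sum_pinnedProfile_le {γ b₀ p₀ : ℝ} (hγ : 0 < γ) (hγ1 : γ ≤ 1) (hb₀ : 0 < b₀) (hp₀ : 1 ≤ p₀) {C : ℝ} (hC : 0 ≤ C) (A : ℕ) {c : ℝ} (hc : 0 < c)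
    (J K : ℕ) :
    ∑ j ∈ Finset.Ioc J K, ∑ _p : Plaq (F.P j) 0,
        C * (F.scheme ℰp γ).β j ^ A * Real.exp (-(c * B10.pFun b₀ p₀ (Real.sqrt (γ * ((F.L : ℝ)⁻¹) ^ j)) ^ 2)) ≤
      (72 * C * (F.L : ℝ) ^ (3 * F.m) * γ⁻¹ ^ A *
          Real.exp ((((3 : ℝ) + A) * Real.log F.L + Real.log 2) ^ 2 / (4 * (c * b₀ ^ 2 * Real.log F.L ^ 2 / 4)))) *
        ((1 : ℝ) / 2) ^ J := by
  have hIoc : Finset.Ioc J K = Finset.Ico (J + 1) (K + 1) := by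
    ext j; simp only [Finset.mem_Ioc, Finset.mem_Ico]; omega
  rw [hIoc]
  refine le_trans ?_ (FluctuationComparisonRegPrIntLSupTailModulus.sum_perHeight_le_geometric F hγ hγ1 hb₀ hp₀ hC A hc J (K + 1))
  refine Finset.sum_le_sum fun j _ => ?_
  have hw : 0 ≤ C * (F.scheme ℰp γ).β j ^ A * Real.exp (-(c * B10.pFun b₀ p₀ (Real.sqrt (γ * ((F.L : ℝ)⁻¹) ^ j)) ^ 2)) :=
    mul_nonneg (mul_nonneg hC (pow_nonneg (F.scheme_β_nonneg ℰp hγ.le j) A)) (Real.exp_nonneg _)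
  rw [Finset.sum_const, Finset.card_univ, nsmul_eq_mul]
  exact mul_le_mul_of_nonneg_right (card_plaq_level_le F j) hw

/-- ★★★ **PINNED ROWS WITH BAŁABAN'S PROFILE ⇒ ✓A's ⟨COND-ODDS⟩ VERBATIM.**  Hypothesis ⟨PINNED-PROFILE⟩ (same quantifier prefix as TAILSUP ∕ COND-ODDS): for every `L`
there is `pS` such that for `0 < b₀`, `pS ≤ p₀`, `0 < p₀` there is `γ₁ > 0` such that for every family `F` with `F.L = L` and `0 < γ ≤ γ₁` there are `C ≥ 0`, `A`,
`c > 0` with, for all `J ≤ K`, all levels `J < j ≤ K`, all plaquettes `p ∈ T_j` and all measurable `B` inside the height-`J` window `{PlaqSmall (θBal L γ b₀ p₀ J)}`: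
`Gibbs_K(D_{J,K}⁻¹B ∩ {θBal L γ b₀ p₀ j ≤ dist1((D_{j,K}U)(∂p))}) ≤ ofReal(C·β_j^A·e^{−c·pFun b₀ p₀(g_j)²})·Gibbs_K(D_{J,K}⁻¹B ∩ histGood (θBal L γ b₀ p₀) K J)`.
Conclusion: the hypothesis ⟨COND-ODDS⟩ of ✓A `windowOddsSupCan_of_condGoodOdds` — hence TAILSUP `WindowOddsSupCan` — with `τ J = A'·2^{−J}` (`pS ↦ max pS 1`, `γ₁ ↦ min γ₁ 1`).
[cite: Balaban1985UV3, (7) p.257, (38)-(40) p.266 and (71) p.273] -/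
theorem condGoodOdds_of_pinnedProfile
    (h : ∀ (L : ℕ), ∃ pS : ℝ, ∀ (b₀ p₀ : ℝ), 0 < b₀ → pS ≤ p₀ → 0 < p₀ →
      ∃ γ₁ : ℝ, 0 < γ₁ ∧ ∀ (F : T3Family) (γ : ℝ), F.L = L → 0 < γ → γ ≤ γ₁ →
        ∃ (C : ℝ) (A : ℕ) (c : ℝ), 0 ≤ C ∧ 0 < c ∧
          ∀ (J K : ℕ) (hJK : J ≤ K) (j : ℕ), J < j → ∀ (hjK : j ≤ K) (p : Plaq (F.P j) 0)
            (B : Set (GaugeField (F.P J) 0 (Matrix.specialUnitaryGroup (Fin 2) ℂ))), MeasurableSet B →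
            B ⊆ {U | PlaqSmall (θBal F.L γ b₀ p₀ J) U} →
            gibbsK F ℰp γ K (descendTo F ℰp J K hJK ⁻¹' B ∩
                {U | θBal F.L γ b₀ p₀ j ≤ dist1 (GaugeField.plaqHol (descendTo F ℰp j K hjK U) p)}) ≤
              ENNReal.ofReal (C * (F.scheme ℰp γ).β j ^ A * Real.exp (-(c * B10.pFun b₀ p₀ (Real.sqrt (γ * ((F.L : ℝ)⁻¹) ^ j)) ^ 2))) *
                gibbsK F ℰp γ K (descendTo F ℰp J K hJK ⁻¹' B ∩ histGood F ℰp (θBal F.L γ b₀ p₀) K J)) :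
    ∀ (L : ℕ), ∃ pS : ℝ, ∀ (b₀ p₀ : ℝ), 0 < b₀ → pS ≤ p₀ → 0 < p₀ →
      ∃ γ₁ : ℝ, 0 < γ₁ ∧ ∀ (F : T3Family) (γ : ℝ), F.L = L → 0 < γ → γ ≤ γ₁ →
        ∃ τ : ℕ → ℝ, (∀ J, 0 ≤ τ J) ∧ (∀ a : ℕ, Tendsto (fun J : ℕ => ((J : ℝ) + 1) ^ a * τ J) atTop (𝓝 0)) ∧
          ∀ (J K : ℕ) (hJK : J ≤ K) (B : Set (GaugeField (F.P J) 0 (Matrix.specialUnitaryGroup (Fin 2) ℂ))), MeasurableSet B →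
            B ⊆ {U | PlaqSmall (θBal F.L γ b₀ p₀ J) U} →
            gibbsK F ℰp γ K (descendTo F ℰp J K hJK ⁻¹' B) ≤
              ENNReal.ofReal (Real.exp (τ J)) * gibbsK F ℰp γ K (descendTo F ℰp J K hJK ⁻¹' B ∩ histGood F ℰp (θBal F.L γ b₀ p₀) K J) := by
  intro L
  obtain ⟨pS, hpS⟩ := h L
  refine ⟨max pS 1, fun b₀ p₀ hb₀ hpS' hp₀ => ?_⟩
  have hp₀1 : 1 ≤ p₀ := le_trans (le_max_right pS 1) hpS'
  obtain ⟨γ₁, hγ₁, hγ₁F⟩ := hpS b₀ p₀ hb₀ (le_trans (le_max_left pS 1) hpS') hp₀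
  refine ⟨min γ₁ 1, lt_min hγ₁ one_pos, fun F γ hFL hγ hγle => ?_⟩
  have hγ1 : γ ≤ 1 := le_trans hγle (min_le_right γ₁ 1)
  obtain ⟨C, A, c, hC, hc, hrows⟩ := hγ₁F F γ hFL hγ (le_trans hγle (min_le_left γ₁ 1))
  set A' : ℝ := 72 * C * (F.L : ℝ) ^ (3 * F.m) * γ⁻¹ ^ A *
      Real.exp ((((3 : ℝ) + A) * Real.log F.L + Real.log 2) ^ 2 / (4 * (c * b₀ ^ 2 * Real.log F.L ^ 2 / 4))) with hA'def
  have hA' : 0 ≤ A' := by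
    rw [hA'def]
    have hL : (0 : ℝ) ≤ F.L := Nat.cast_nonneg _
    have : 0 ≤ γ⁻¹ := inv_nonneg.mpr hγ.le
    positivity
  refine ⟨fun J => A' * ((1 : ℝ) / 2) ^ J, fun J => mul_nonneg hA' (pow_nonneg (by norm_num) J),
    fun a => FluctuationComparisonRegPrIntLSupTailModulus.tendsto_pow_mul_geometric a A', ?_⟩
  intro J K hJK B hB hBW
  -- the pinned rows at `(J, K)` with the plaquette-uniform profile weight
  set w : (j : ℕ) → Plaq (F.P j) 0 → ℝ := fun j _ =>
    C * (F.scheme ℰp γ).β j ^ A * Real.exp (-(c * B10.pFun b₀ p₀ (Real.sqrt (γ * ((F.L : ℝ)⁻¹) ^ j)) ^ 2)) with hwdef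
  have hw : ∀ j (p : Plaq (F.P j) 0), 0 ≤ w j p := fun j _ =>
    mul_nonneg (mul_nonneg hC (pow_nonneg (F.scheme_β_nonneg ℰp hγ.le j) A)) (Real.exp_nonneg _)
  have hmain := condGoodOdds_of_pinnedRows F γ (θBal F.L γ b₀ p₀) hJK w hw hBW
    (fun j hJj hjK p => hrows J K hJK j hJj hjK p B hB hBW)
  refine hmain.trans (mul_le_mul' (ENNReal.ofReal_le_ofReal (Real.exp_le_exp.mpr ?_)) le_rfl)
  -- `log(1 + ΣΣ w) ≤ ΣΣ w ≤ A'·2^{−J}`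
  have hS0 : 0 ≤ ∑ j ∈ Finset.Ioc J K, ∑ p : Plaq (F.P j) 0, w j p :=
    Finset.sum_nonneg fun j _ => Finset.sum_nonneg fun p _ => hw j p
  have hlog : Real.log (1 + ∑ j ∈ Finset.Ioc J K, ∑ p : Plaq (F.P j) 0, w j p) ≤ ∑ j ∈ Finset.Ioc J K, ∑ p : Plaq (F.P j) 0, w j p := by
    rw [Real.log_le_iff_le_exp (by linarith)]
    linarith [Real.add_one_le_exp (∑ j ∈ Finset.Ioc J K, ∑ p : Plaq (F.P j) 0, w j p)]
  exact hlog.trans (sum_pinnedProfile_le F hγ hγ1 hb₀ hp₀1 hC A hc J K)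

/-! ## §5 The door, one name: ⟨PINNED-PROFILE⟩ ⇒ TAILSUP `WindowOddsSupCan` verbatim (§4 ∘ ✓A) -/

/-- ★★★ **⟨PINNED-PROFILE⟩ ⇒ TAILSUP** (LINE g21-1 `suptail_split`'s row `RunPairOrgan.OneLoop.WindowOddsSupCan`, text verbatim): per-(level, plaquette) pinned Gibbs rows with
Bałaban's profile weight `C·β_j^A·e^{−c·pFun(g_j)²}` above every measurable `B` inside the height-`J` window give the level-free a-posteriori window bound
`0 ≤ log ρ − c − log h_K^{hist} ≤ τ(J)` with `τ(J) = A'·2^{−J}` superpolynomially small — `condGoodOdds_of_pinnedProfile` then ✓A `windowOddsSupCan_of_condGoodOdds`.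
HONEST SCOPE: the pinned rows are the HYPOTHESIS (LINE g21-2's PPT ∕ FPT programme, full window; R3-FLIN exposes the full-window moderate rows at `L = 3, 5` — the interior
∘-editions are the live ones); nothing upstream is proved here. [cite: Balaban1985UV3, (7) p.257, (38)-(40) p.266 and (71) p.273] -/
theorem windowOddsSup_of_pinnedProfile
    (h : ∀ (L : ℕ), ∃ pS : ℝ, ∀ (b₀ p₀ : ℝ), 0 < b₀ → pS ≤ p₀ → 0 < p₀ →
      ∃ γ₁ : ℝ, 0 < γ₁ ∧ ∀ (F : T3Family) (γ : ℝ), F.L = L → 0 < γ → γ ≤ γ₁ →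
        ∃ (C : ℝ) (A : ℕ) (c : ℝ), 0 ≤ C ∧ 0 < c ∧
          ∀ (J K : ℕ) (hJK : J ≤ K) (j : ℕ), J < j → ∀ (hjK : j ≤ K) (p : Plaq (F.P j) 0)
            (B : Set (GaugeField (F.P J) 0 (Matrix.specialUnitaryGroup (Fin 2) ℂ))), MeasurableSet B →
            B ⊆ {U | PlaqSmall (θBal F.L γ b₀ p₀ J) U} →
            gibbsK F ℰp γ K (descendTo F ℰp J K hJK ⁻¹' B ∩
                {U | θBal F.L γ b₀ p₀ j ≤ dist1 (GaugeField.plaqHol (descendTo F ℰp j K hjK U) p)}) ≤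
              ENNReal.ofReal (C * (F.scheme ℰp γ).β j ^ A * Real.exp (-(c * B10.pFun b₀ p₀ (Real.sqrt (γ * ((F.L : ℝ)⁻¹) ^ j)) ^ 2))) *
                gibbsK F ℰp γ K (descendTo F ℰp J K hJK ⁻¹' B ∩ histGood F ℰp (θBal F.L γ b₀ p₀) K J)) :
    ∀ (L : ℕ), ∃ pS : ℝ, ∀ (b₀ p₀ : ℝ), 0 < b₀ → pS ≤ p₀ → 0 < p₀ →
      ∃ γ₁ : ℝ, 0 < γ₁ ∧ ∀ (F : T3Family) (γ : ℝ), F.L = L → 0 < γ → γ ≤ γ₁ →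
        ∃ τ : ℕ → ℝ, (∀ J, 0 ≤ τ J) ∧ (∀ a : ℕ, Tendsto (fun J : ℕ => ((J : ℝ) + 1) ^ a * τ J) atTop (𝓝 0)) ∧
          ∀ (ν : ℕ → (j : ℕ) → Measure (GaugeField (F.P j) 0 (Matrix.specialUnitaryGroup (Fin 2) ℂ))),
            (∀ K, ν K K = T4GenFunBounds.gibbsMeasure (F.P K) ((F.scheme ℰp γ).β K)) →
            (∀ K j, j < K → ν K j = Measure.map (descend F ℰp j) (ν K (j + 1))) →
            ∀ (J K : ℕ) (hJK : J ≤ K) (ρ : GaugeField (F.P J) 0 (Matrix.specialUnitaryGroup (Fin 2) ℂ) → ℝ),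
              (∀ U, PlaqSmall (θBal F.L γ b₀ p₀ J) U → 0 < ρ U) →
              ν K J = (fieldMeasure _ _ _).withDensity (fun U => ENNReal.ofReal (ρ U)) →
              ContinuousOn ρ {U | PlaqSmall (θBal F.L γ b₀ p₀ J) U} →
              (∀ U : GaugeField (F.P J) 0 (Matrix.specialUnitaryGroup (Fin 2) ℂ), PlaqSmall (θBal F.L γ b₀ p₀ J) U →
                  0 < heightDensityCan F γ hJK (histGood F ℰp (θBal F.L γ b₀ p₀) K J) U) →
              ∃ c : ℝ, ∀ U : GaugeField (F.P J) 0 (Matrix.specialUnitaryGroup (Fin 2) ℂ), PlaqSmall (θBal F.L γ b₀ p₀ J) U →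
                0 ≤ Real.log (ρ U) - c - Real.log (heightDensityCan F γ hJK (histGood F ℰp (θBal F.L γ b₀ p₀) K J) U) ∧
                Real.log (ρ U) - c - Real.log (heightDensityCan F γ hJK (histGood F ℰp (θBal F.L γ b₀ p₀) K J) U) ≤ τ J :=
  FluctuationComparisonRegPrIntLSupTailReduction.windowOddsSupCan_of_condGoodOdds (condGoodOdds_of_pinnedProfile h)

end Runs

end Summit.QuantumFields.YangMills.Theorems.FluctuationComparisonRegPrIntLSupTailCoverUnion

end
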